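import Summits.Ventures.CertifiedManyBodySolver.Downfold.BoxesNdNiO2E
import Summits.Ventures.CertifiedManyBodySolver.Downfold.ParameterBoxRebase
import Summits.Ventures.CertifiedManyBodySolver.Downfold.TAxisSeam
import HarnessLib

/-!
# THE TYPED UNCERTAINTY LADDER of the NdNiO₂ one-band OBJECT-E box (BOX OF RECORD #20, column M21):
# members with locators → hulls → FLOOR / INFL rungs → quotient rung → kernel-checked ENCLOSURE by `boxNdNiO2E_M21`

Venture CertifiedManyBodySolver, cell `pub/hubbard-downfold` (S1 = ROUTER; D-0154 (1) (C) COVERAGE (iii) NdNiO₂), seat hubbard-cov-ndnio2-unc-2.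
SOURCE OF EVERY NUMBER: `router/BOXES/NdNiO2.md` §LIT-PREVIEW v1/v1.1 (lit-2), §DFT-1b v1 + v1.1 OBJECT-E addendum (run-8), §OF-RECORD v1.1 /
v1.5 (R-ac) / v1.6 / v1.7 (R-ak) (lead), §R-ac FOLD v1 + §U-MEMBERS v1 (run-8 on RULING R-as). Target typed box: `boxNdNiO2E_M21`
(`BoxesNdNiO2E.lean`): `U/t_eff [5, 17/2]`, `t'/t_eff [−23/50, −9/25]`, `n [213/250, 477/500]`, `t_eff [19/50, 49/100]` eV, `t''/t_eff = 0`.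
A box row of record is `members ↦ hull (never averaged) ↦ floorTo (FLOOR = minimum half-width) ↦ named pads ↦ outward print` (ROUTER v0.5 A5,
BOX-SCHEMA R2–R4), and `U/t = divPos(U row, own t row)`; every rung below is an exact rational interval and every arrow a PROVED inclusion.
* §1 one-band `U` (eV): the five member lines (six values) of §U-MEMBERS v1 with locators; hull `[247/100, 16/5]` = least printed-end enclosure
  (edge members: in-house cRPA(W)@PBE 26-Ry rung 2.47 / Kitatani 2020 3.2); FLOOR(U-lit) 10 % inactive; context values typed as OUTSIDE
  (cRPA@GW 3.508, extrapolation 2.40); the in-house (W)/(D) cutoff ladders as decreasing chains ending at the 26-Ry point members.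
* §2 object-E `t_eff` (eV): the `t–t'` refit members of §DFT-1b v1.1, hull `[0.3836, 0.4688]`, FLOOR(t) 8 % inactive, INFL-T `+3 %` on the high
  edge ⇒ rung `[0.3836, 0.482864]` ⊆ `ndNiO2E_M21_t`.
* §3 object-E `t'/t_eff`: hull `[−0.455, −0.360]` ⊆ `ndNiO2E_M21_tp`; FLOOR(tp/t) `1/20` ACTIVE ⇒ `[−0.4575, −0.3575]`, NOT ⊆ `ndNiO2E_M21_tp`
  on the high side by `1/400` (`…_tp_floor_not_le_entry`): the typed companion carries the v1.1 print `[−0.46, −0.36]`, which predates run-8's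
  OUTWARD re-print `[−0.458, −0.357]` (§R-ac FOLD v1, adopted §OF-RECORD v1.6 (B)) — typed in the sequel `BoxesNdNiO2EReprint.lean`.
* §4 `dsd` members (three objects hulled by the box file) `↦ [0.064, 0.13] ↦` INFL-4f floor `1/20` ACTIVE `↦ [0.047, 0.147]`; `n = 1 − dsd ⊆ ndNiO2E_M21_n`.
* §5 `ndNiO2E_UoverT_exact = divPos([2.47, 3.2], [0.38, 0.49]) = [247/49, 160/19]` ⊆ `[5, 17/2]` (R-ak's construction, exact; slacks `2/49`, `3/38`);
  **`ndNiO2E_M21_mem_of_determination`**: every admitted determination (U in the hull ÷ t_eff in its rung, t'/t_eff in its hull, n = 1 − dsd,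
  t'' = 0) IS a member of `boxNdNiO2E_M21` — the soundness direction that makes every `HoldsOn W boxNdNiO2E_M21` apply to it.
* The re-printed `t'/t_eff` row `[−0.458, −0.357]` as a one-coordinate re-issue, and its (non-)refinement relations with `boxNdNiO2E_M21`,
  are the sequel `BoxesNdNiO2EReprint.lean` (kept apart: it asks the lead for a ruling; §1–§5 do not).

Everything PROVED (no `sorry`, no named fact). HONEST FRAMING: SCREENING-GRADE / `[float]` inputs typed VERBATIM as exact rationals — the file
certifies the ARITHMETIC member → box, nothing about any member's physics or about NdNiO₂; no word, no hull move, no new member. Object M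
and the doping columns M22/M59/M60/M279 are not typed here.
-/


namespace Summit.Ventures.CertifiedManyBodySolver.Downfold

open NonemptyInterval Literature.MathematicalPhysics.QuantumLattice
  Literature.MathematicalPhysics.QuantumLattice.ThermodynamicLimit

/-! ## §1 The one-band `U` member lines of §U-MEMBERS v1 and their hull `[2.47, 3.2]` eV -/

/-- **The admitted one-band `U` members of NdNiO₂ (eV), §U-MEMBERS v1 of `router/BOXES/NdNiO2.md` (lead RULING R-as
2026-08-27T05:35:51Z; hull of record R-ac 03:30Z)** — one exact rational per printed determination:
(1) `2578/1000`, `2608/1000`: cRPA@GGA, weighting (W) construction, NdNiO₂ with Nd-4f in core, RESPACK/QE and xTAPP — Nomura et al.,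
PRB 100 205138 (2019), arXiv:1909.03942 Table III p.6 `[float]`; (2) `2910/1000`: cRPA@LDA, disentangled (D) construction, «YNiO₂» 4f-free
proxy at the LaNiO₂ lattice, FP-LMTO — Hirayama, Nomura, Arita, Front. Phys. 10 (2022), arXiv:2202.03661 Table 3 `[float]` (lead
03:37:16Z: ADMITTED, interior); (3) `32/10`: the one-band `U = 8t` adopted for DΓA, «slightly larger than cRPA» — Kitatani et al., npj QM 5
59 (2020), arXiv:2002.12230 p.3 L2–6 `[float]`; (4) `247/100`: in-house cRPA(W)@PBE, La-proxy LaNiO₂ at the NdNiO₂ cell, 26-Ry POINT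
MEMBER (tool-1 gate line 05:34:20Z; prov CRPA-py:j268536/j268864/j266630/j263107; SCREENING-GRADE); (5) `31/10`: in-house cRPA(D)@PBE, same
Wannier functions, 26-Ry POINT MEMBER (prov CRPA-py:j267003; SCREENING-GRADE). [folklore] -/
def ndNiO2_oneBandU_members : Finset ℚ := {2578/1000, 2608/1000, 2910/1000, 32/10, 247/100, 31/10}

/-- **The one-band `U_abs` hull of record** `[247/100, 16/5] = [2.47, 3.2]` eV (§R-ac FOLD v1 row `U_abs`; was `[2.578, 3.2]` before
R-ac admitted the in-house (W) member). [folklore] -/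
def ndNiO2_oneBandU_hull : NonemptyInterval ℚ := ⟨(247/100, 16/5), by norm_num⟩

/-- Every admitted `U` member lies in the hull of record. [folklore] -/
theorem ndNiO2_oneBandU_members_subset_hull :
    ∀ m ∈ ndNiO2_oneBandU_members, ndNiO2_oneBandU_hull.fst ≤ m ∧ m ≤ ndNiO2_oneBandU_hull.snd := by
  intro m hm
  simp only [ndNiO2_oneBandU_members, Finset.mem_insert, Finset.mem_singleton] at hm
  rcases hm with rfl | rfl | rfl | rfl | rfl | rfl <;>
    simp only [ndNiO2_oneBandU_hull] <;> norm_num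

/-- **The hull is the LEAST printed-end enclosure**: both end points are members — low edge `2.47` = the in-house cRPA(W)@PBE 26-Ry
rung, high edge `3.2` = Kitatani 2020's adopted value (the EDGE MEMBERS named in §U-MEMBERS v1). [folklore] -/
theorem ndNiO2_oneBandU_hull_ends_mem :
    ndNiO2_oneBandU_hull.fst ∈ ndNiO2_oneBandU_members ∧ ndNiO2_oneBandU_hull.snd ∈ ndNiO2_oneBandU_members := by
  simp only [ndNiO2_oneBandU_hull, ndNiO2_oneBandU_members, Finset.mem_insert, Finset.mem_singleton]
  norm_num

/-- Any rational interval containing all members contains the hull (minimality, interval form). [folklore] -/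
theorem ndNiO2_oneBandU_hull_le_of_forall_mem {J : NonemptyInterval ℚ}
    (hJ : ∀ m ∈ ndNiO2_oneBandU_members, J.fst ≤ m ∧ m ≤ J.snd) : ndNiO2_oneBandU_hull ≤ J :=
  ⟨(hJ _ ndNiO2_oneBandU_hull_ends_mem.1).1, (hJ _ ndNiO2_oneBandU_hull_ends_mem.2).2⟩

/-- **FLOOR(U-lit) is inactive**: the floor `10 %` of the midpoint `567/200` is `567/2000 = 0.2835 ≤` half-width `73/200 = 0.365`, so
`floorTo` returns the hull itself (§R-ac FOLD v1: «half-width 0.365 ≥ floor 0.2835 ⇒ none»). [folklore] -/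
theorem ndNiO2_oneBandU_floor_eq_hull :
    ndNiO2_oneBandU_hull.floorTo (567/2000) = ndNiO2_oneBandU_hull :=
  NonemptyInterval.floorTo_eq_self_of_le (by simp only [ndNiO2_oneBandU_hull, NonemptyInterval.halfWidth]; norm_num)

/-- The FLOOR radius used above IS 10 % of the hull midpoint (no hidden constant). [folklore] -/
theorem ndNiO2_oneBandU_floor_is_tenPercent_midpoint :
    (567/2000 : ℚ) = ndNiO2_oneBandU_hull.midpoint / 10 := by
  simp only [ndNiO2_oneBandU_hull, NonemptyInterval.midpoint]; norm_num

/-- **Context value NOT in the hull (typed reason)**: the cRPA@GW member `3508/1000` eV of Hirayama–Nomura–Arita 2022 Table 4 (GW one-body +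
cRPA@GW; `|U/t|` 12.9 with the authors' caution) is CONTEXT by ruling R-o (GW/MACE-level values are context for nickelate words) — it lies
ABOVE the hull, so admitting it would be an edge event, not an interior addition. [folklore] -/
theorem ndNiO2_oneBandU_gwContext_not_mem : ¬ (ndNiO2_oneBandU_hull.fst ≤ (3508/1000 : ℚ) ∧ (3508/1000 : ℚ) ≤ ndNiO2_oneBandU_hull.snd) := by
  simp only [ndNiO2_oneBandU_hull]; norm_num

/-- **Context value NOT in the hull (typed reason)**: the in-house geometric-tail EXTRAPOLATION `240/100` eV (tool-1 03:27:38Z) is CONTEXT,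
not a rung (R-o/R-ac: the point member is the 26-Ry rung) — it lies BELOW the hull. [folklore] -/
theorem ndNiO2_oneBandU_extrapolation_not_mem :
    ¬ (ndNiO2_oneBandU_hull.fst ≤ (240/100 : ℚ) ∧ (240/100 : ℚ) ≤ ndNiO2_oneBandU_hull.snd) := by
  simp only [ndNiO2_oneBandU_hull]; norm_num

/-- **The in-house cRPA(W)@PBE cutoff LADDER** (convergence CONTEXT, tool-1 gate line 05:34:20Z): `U = 2.97 / 2.66 / 2.53 / 2.47` eV at
`10 / 15 / 20 / 26` Ry is strictly DECREASING in the cutoff and its last rung IS the hull's low edge (the admitted 26-Ry point member; R-o/R-ac/R-as: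
«point member = the 26-Ry rung», the other rungs are context). [folklore] -/
theorem ndNiO2_inhouseW_cutoffLadder_decreasing :
    (297/100 : ℚ) > 266/100 ∧ (266/100 : ℚ) > 253/100 ∧ (253/100 : ℚ) > 247/100 ∧ (247/100 : ℚ) = ndNiO2_oneBandU_hull.fst := by
  simp only [ndNiO2_oneBandU_hull]; norm_num

/-- **The in-house cRPA(D)@PBE cutoff ladder** `3.40 / 3.16 / 3.11 / 3.10` eV at `10 / 15 / 20 / 26` Ry (tool-1 05:34:20Z; context but for the last
rung): strictly decreasing; the 26-Ry point member `3.10` is INTERIOR, while the unconverged 10-Ry rung `3.40` lies ABOVE the hull — admitting a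
non-26-Ry rung would have been an edge event (why R-as pins the point member to the 26-Ry rung). [folklore] -/
theorem ndNiO2_inhouseD_cutoffLadder_decreasing :
    (340/100 : ℚ) > 316/100 ∧ (316/100 : ℚ) > 311/100 ∧ (311/100 : ℚ) > 31/10 ∧
      (ndNiO2_oneBandU_hull.fst < (31/10 : ℚ) ∧ (31/10 : ℚ) < ndNiO2_oneBandU_hull.snd) ∧ ndNiO2_oneBandU_hull.snd < (340/100 : ℚ) := by
  simp only [ndNiO2_oneBandU_hull]; norm_num

/-! ## §2 Object-E `t_eff` (eV): the `t–t'` refit members of §DFT-1b v1.1, hull, FLOOR, INFL-T, enclosure -/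

/-- **The object-E `t_eff` members (eV), §DFT-1b v1.1 OBJECT-E addendum of `router/BOXES/NdNiO2.md` (run-8 2026-08-26T19:14:25Z)** —
least-squares `t–t'` refits (windows `w = 0.3 / 0.5` eV) of two bracketing input bands: (W) the one-band MLWF band — p0 WAN:j257807
`0.4181 / 0.4258`, the same anchored at the band's own `n = 0.928` level `0.4007 / 0.4151`, sto WAN:j257812 `0.4263 / 0.4324`, the `x = 0.2`
charged cell WAN:j257052 `0.4688 / 0.4679` (INFL-dop member, hulled by the row's prov); (D) the DFT conduction band — p0 DFT:j257807
`0.3947 / 0.4505`, at `n = 0.928` `0.3836 / 0.4505`, sto DFT:j257812 `0.4017 / 0.4582`. All SCREENING-GRADE DERIVED. [folklore] -/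
def ndNiO2E_t_members : Finset ℚ :=
  {4181/10000, 4258/10000, 4007/10000, 4151/10000, 4263/10000, 4324/10000, 4688/10000, 4679/10000,
   3947/10000, 4505/10000, 3836/10000, 4017/10000, 4582/10000}

/-- **The object-E `t_eff` member hull** `[959/2500, 293/625] = [0.3836, 0.4688]` eV (the row's printed `prov=hull [0.3836, 0.4688]`). [folklore] -/
def ndNiO2E_t_hull : NonemptyInterval ℚ := ⟨(3836/10000, 4688/10000), by norm_num⟩

/-- Every `t_eff` member lies in the member hull. [folklore] -/
theorem ndNiO2E_t_members_subset_hull :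
    ∀ m ∈ ndNiO2E_t_members, ndNiO2E_t_hull.fst ≤ m ∧ m ≤ ndNiO2E_t_hull.snd := by
  intro m hm
  simp only [ndNiO2E_t_members, Finset.mem_insert, Finset.mem_singleton] at hm
  rcases hm with rfl | rfl | rfl | rfl | rfl | rfl | rfl | rfl | rfl | rfl | rfl | rfl | rfl <;>
    simp only [ndNiO2E_t_hull] <;> norm_num

/-- The `t_eff` hull is least: both ends are members (low = (D) p0 at `n = 0.928`, `w = 0.3`; high = (W) `x = 0.2` charged cell, `w = 0.3`). [folklore] -/
theorem ndNiO2E_t_hull_ends_mem :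
    ndNiO2E_t_hull.fst ∈ ndNiO2E_t_members ∧ ndNiO2E_t_hull.snd ∈ ndNiO2E_t_members := by
  simp only [ndNiO2E_t_hull, ndNiO2E_t_members, Finset.mem_insert, Finset.mem_singleton]; norm_num

/-- **FLOOR(t) 8 % is inactive on object E**: `8 %` of the midpoint `0.4262` is `2131/62500 = 0.034096 ≤` half-width `0.0426` (the row:
«FLOOR(t) ±8 % → none (hull half-width 0.043 ≥ 0.034)»). [folklore] -/
theorem ndNiO2E_t_floor_eq_hull : ndNiO2E_t_hull.floorTo (2131/62500) = ndNiO2E_t_hull :=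
  NonemptyInterval.floorTo_eq_self_of_le (by simp only [ndNiO2E_t_hull, NonemptyInterval.halfWidth]; norm_num)

/-- The FLOOR radius used above IS 8 % of the hull midpoint. [folklore] -/
theorem ndNiO2E_t_floor_is_eightPercent_midpoint : (2131/62500 : ℚ) = ndNiO2E_t_hull.midpoint * (8/100) := by
  simp only [ndNiO2E_t_hull, NonemptyInterval.midpoint]; norm_num

/-- **The INFL-T rung**: `+3 %` on the HIGH edge only (300-K maps; the row: «INFL-T +3 % on hi → 0.483») ⇒ `[0.3836, 0.4688·1.03] =
[959/2500, 30179/62500] = [0.3836, 0.482864]` eV. [folklore] -/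
def ndNiO2E_t_rung : NonemptyInterval ℚ := ⟨(3836/10000, 30179/62500), by norm_num⟩

/-- The INFL-T rung's ends ARE `(hull.fst, hull.snd · 103/100)` (no hidden constant). [folklore] -/
theorem ndNiO2E_t_rung_ends : ndNiO2E_t_rung.fst = ndNiO2E_t_hull.fst ∧ ndNiO2E_t_rung.snd = ndNiO2E_t_hull.snd * (103/100) := by
  simp only [ndNiO2E_t_rung, ndNiO2E_t_hull]; norm_num

/-- Hull ⊆ INFL-T rung. [folklore] -/
theorem ndNiO2E_t_hull_le_rung : ndNiO2E_t_hull ≤ ndNiO2E_t_rung := by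
  refine ⟨?_, ?_⟩ <;> simp only [ndNiO2E_t_rung, ndNiO2E_t_hull] <;> norm_num

/-- **ENCLOSURE of the `t_eff` ladder by the typed entry**: INFL-T rung `⊆ ndNiO2E_M21_t.encl = [19/50, 49/100]` (outward 2-decimal print;
slack `0.0036` low / `0.007136` high). [folklore] -/
theorem ndNiO2E_t_rung_le_entry : ndNiO2E_t_rung ≤ ndNiO2E_M21_t.encl := by
  refine ⟨?_, ?_⟩ <;>
    simp only [ndNiO2E_t_rung, ndNiO2E_M21_t, Entry.encl_ofEnds_fst, Entry.encl_ofEnds_snd] <;> norm_num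

/-- Hence every real in the `t_eff` rung (in particular every member and every INFL-T image of one) is enclosed by the typed `t_eff` entry of
`boxNdNiO2E_M21`. [folklore] -/
theorem ndNiO2E_M21_t_mem_of_mem_rung {t : ℝ} (ht : t ∈ ndNiO2E_t_rung.ratCast ℝ) : ndNiO2E_M21_t.Mem t :=
  mem_ratCast_of_le ndNiO2E_t_rung_le_entry ht

/-- Member form: every printed `t_eff` member, cast to `ℝ`, is enclosed by `ndNiO2E_M21_t`. [folklore] -/
theorem ndNiO2E_M21_t_mem_of_member {m : ℚ} (hm : m ∈ ndNiO2E_t_members) : ndNiO2E_M21_t.Mem (m : ℝ) := by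
  have h := ndNiO2E_t_members_subset_hull m hm
  refine ndNiO2E_M21_t_mem_of_mem_rung (mem_ratCast_of_le ndNiO2E_t_hull_le_rung ?_)
  exact mem_ratCast_iff.2 ⟨by exact_mod_cast h.1, by exact_mod_cast h.2⟩

/-! ## §3 Object-E `t'/t_eff`: members, hull, the ACTIVE FLOOR rung, and what the typed entry does / does not enclose -/

/-- **The object-E `t'/t_eff` members, §DFT-1b v1.1** (same fourteen refits as §2, same order; twelve distinct values): (W) p0 `−0.399 / −0.377`, p0 at `n = 0.928`
`−0.407 / −0.386`, sto `−0.397 / −0.375`, `x = 0.2` charged `−0.378 / −0.360`; (D) p0 `−0.455 / −0.409`, p0 at `n = 0.928` `−0.454 / −0.409`,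
sto `−0.454 / −0.408`. SCREENING-GRADE DERIVED. [folklore] -/
def ndNiO2E_tp_members : Finset ℚ :=
  {-399/1000, -377/1000, -407/1000, -386/1000, -397/1000, -375/1000, -378/1000, -360/1000,
   -455/1000, -409/1000, -454/1000, -408/1000}

/-- **The object-E `t'/t_eff` member hull** `[−91/200, −9/25] = [−0.455, −0.360]` (the row's `prov=hull [−0.455, −0.360]`). [folklore] -/
def ndNiO2E_tp_hull : NonemptyInterval ℚ := ⟨(-455/1000, -360/1000), by norm_num⟩

/-- Every `t'/t_eff` member lies in the member hull. [folklore] -/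
theorem ndNiO2E_tp_members_subset_hull :
    ∀ m ∈ ndNiO2E_tp_members, ndNiO2E_tp_hull.fst ≤ m ∧ m ≤ ndNiO2E_tp_hull.snd := by
  intro m hm
  simp only [ndNiO2E_tp_members, Finset.mem_insert, Finset.mem_singleton] at hm
  rcases hm with rfl | rfl | rfl | rfl | rfl | rfl | rfl | rfl | rfl | rfl | rfl | rfl <;>
    simp only [ndNiO2E_tp_hull] <;> norm_num

/-- The `t'/t_eff` hull is least: both ends are members (low = (D) p0 `w = 0.3`, high = (W) `x = 0.2` charged cell `w = 0.5`). [folklore] -/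
theorem ndNiO2E_tp_hull_ends_mem :
    ndNiO2E_tp_hull.fst ∈ ndNiO2E_tp_members ∧ ndNiO2E_tp_hull.snd ∈ ndNiO2E_tp_members := by
  simp only [ndNiO2E_tp_hull, ndNiO2E_tp_members, Finset.mem_insert, Finset.mem_singleton]; norm_num

/-- **FLOOR(tp/t) `1/20` is ACTIVE on object E**: the member half-width `19/400 = 0.0475 < 0.05`, so the floored row is `midpoint ± 1/20 =
[−183/400, −143/400] = [−0.4575, −0.3575]` (the row: «with the floor as minimum the enclosure is midpoint −0.4076 ± 0.05»). [folklore] -/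
theorem ndNiO2E_tp_floor_ends :
    (ndNiO2E_tp_hull.floorTo (1/20)).fst = -183/400 ∧ (ndNiO2E_tp_hull.floorTo (1/20)).snd = -143/400 := by
  have h := NonemptyInterval.floorTo_eq_of_le (I := ndNiO2E_tp_hull) (F := 1/20)
    (by simp only [ndNiO2E_tp_hull, NonemptyInterval.halfWidth]; norm_num)
  rw [h.1, h.2]
  simp only [ndNiO2E_tp_hull, NonemptyInterval.midpoint]; norm_num

/-- **The member hull IS enclosed by the typed entry** `ndNiO2E_M21_tp.encl = [−23/50, −9/25] = [−0.46, −0.36]` (high ends coincide: the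
`x = 0.2` charged-cell member `−0.360` sits ON the typed edge). [folklore] -/
theorem ndNiO2E_tp_hull_le_entry : ndNiO2E_tp_hull ≤ ndNiO2E_M21_tp.encl := by
  refine ⟨?_, ?_⟩ <;>
    simp only [ndNiO2E_tp_hull, ndNiO2E_M21_tp, Entry.encl_ofEnds_fst, Entry.encl_ofEnds_snd] <;> norm_num

/-- Member form: every printed `t'/t_eff` member is enclosed by `ndNiO2E_M21_tp`. [folklore] -/
theorem ndNiO2E_M21_tp_mem_of_member {m : ℚ} (hm : m ∈ ndNiO2E_tp_members) : ndNiO2E_M21_tp.Mem (m : ℝ) := by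
  have h := ndNiO2E_tp_members_subset_hull m hm
  exact mem_ratCast_of_le ndNiO2E_tp_hull_le_entry (mem_ratCast_iff.2 ⟨by exact_mod_cast h.1, by exact_mod_cast h.2⟩)

/-- **The FLOOR rung is NOT enclosed by the typed entry** (high side): `(floorTo hull 1/20).snd = −143/400 = −0.3575 > −9/25 = −0.36` by
`1/400`. The typed companion `boxNdNiO2E_M21` carries the §OF-RECORD v1.1 print `[−0.46, −0.36]` (outward 2-decimal rounding of the HULL,
inward of the FLOOR rung); run-8's §R-ac FOLD v1 legacy re-print `[−0.458, −0.357]` (adopted §OF-RECORD v1.6 (B)) encloses the rung — sequel file. [folklore] -/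
theorem ndNiO2E_tp_floor_not_le_entry : ¬ ndNiO2E_tp_hull.floorTo (1/20) ≤ ndNiO2E_M21_tp.encl := by
  intro h
  have h2 := h.2
  rw [ndNiO2E_tp_floor_ends.2] at h2
  simp only [ndNiO2E_M21_tp, Entry.encl_ofEnds_snd] at h2
  norm_num at h2

/-- The low side of the FLOOR rung IS enclosed by the typed entry (`−23/50 ≤ −183/400`). [folklore] -/
theorem ndNiO2E_tp_floor_fst_ge_entry : ndNiO2E_M21_tp.encl.fst ≤ (ndNiO2E_tp_hull.floorTo (1/20)).fst := by
  rw [ndNiO2E_tp_floor_ends.1]; simp only [ndNiO2E_M21_tp, Entry.encl_ofEnds_fst]; norm_num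

/-! ## §4 Self-doping `dsd` and the M21 filling `n = 1 − dsd` -/

/-- **The `dsd` members of the parent column (e per Ni), §DFT-1b v1 `dsd` row**: `0.064` = pocket Luttinger volume on the 10³ grid (A 0.046 + Γ 0.018,
DFT:j257807); `0.072` = `1 −` band count of the per-k-assigned Ni-x²−y² band (DFT:j257807); `0.068 / 0.072` sto leg (DFT:j257812); `0.13` = `1 − 0.87`,
the Ni-x²−y² orbital occupation in Nomura 2019's three-orbital analysis (arXiv:1909.03942 p.5 L85–88, `[float]`). THREE OBJECTS kept apart in
the box file (reservoir charge · band count · orbital occupation) and HULLED by it; typed as hulled. [folklore] -/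
def ndNiO2_dsd_members : Finset ℚ := {64/1000, 72/1000, 68/1000, 13/100}

/-- **The `dsd` member hull** `[8/125, 13/100] = [0.064, 0.13]`. [folklore] -/
def ndNiO2_dsd_hull : NonemptyInterval ℚ := ⟨(64/1000, 13/100), by norm_num⟩

/-- Every `dsd` member lies in the hull, and both ends are members. [folklore] -/
theorem ndNiO2_dsd_members_subset_hull_and_ends :
    (∀ m ∈ ndNiO2_dsd_members, ndNiO2_dsd_hull.fst ≤ m ∧ m ≤ ndNiO2_dsd_hull.snd) ∧
      ndNiO2_dsd_hull.fst ∈ ndNiO2_dsd_members ∧ ndNiO2_dsd_hull.snd ∈ ndNiO2_dsd_members := by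
  refine ⟨?_, ?_⟩
  · intro m hm
    simp only [ndNiO2_dsd_members, Finset.mem_insert, Finset.mem_singleton] at hm
    rcases hm with rfl | rfl | rfl | rfl <;> simp only [ndNiO2_dsd_hull] <;> norm_num
  · simp only [ndNiO2_dsd_hull, ndNiO2_dsd_members, Finset.mem_insert, Finset.mem_singleton]; norm_num

/-- **The INFL-4f class floor `1/20` is ACTIVE on `dsd`** (> FLOOR(dsd) 0.03; member half-width `0.033 < 0.05`): floored row `midpoint ± 1/20 =
[47/1000, 147/1000]` = the printed `dsd` row `[0.047, 0.147]` EXACTLY. [folklore] -/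
theorem ndNiO2_dsd_floor_ends :
    (ndNiO2_dsd_hull.floorTo (1/20)).fst = 47/1000 ∧ (ndNiO2_dsd_hull.floorTo (1/20)).snd = 147/1000 := by
  have h := NonemptyInterval.floorTo_eq_of_le (I := ndNiO2_dsd_hull) (F := 1/20)
    (by simp only [ndNiO2_dsd_hull, NonemptyInterval.halfWidth]; norm_num)
  rw [h.1, h.2]
  simp only [ndNiO2_dsd_hull, NonemptyInterval.midpoint]; norm_num

/-- **ENCLOSURE of the filling ladder**: for every `dsd` in the floored row, `n = 1 − dsd ∈ [853/1000, 953/1000]` lies in the typed filling entry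
`ndNiO2E_M21_n.encl = [213/250, 477/500] = [0.852, 0.954]` (printed outward by `0.001` each side; FLOOR(n) ±0.01 inactive). [folklore] -/
theorem ndNiO2E_M21_n_mem_of_dsd {d : ℝ} (hd : d ∈ (ndNiO2_dsd_hull.floorTo (1/20)).ratCast ℝ) : ndNiO2E_M21_n.Mem (1 - d) := by
  rw [mem_ratCast_iff, ndNiO2_dsd_floor_ends.1, ndNiO2_dsd_floor_ends.2] at hd
  rw [Entry.Mem, mem_ratCast_iff, ndNiO2E_M21_n, Entry.encl_ofEnds_fst, Entry.encl_ofEnds_snd]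
  obtain ⟨h1, h2⟩ := hd
  constructor
  · have : (((213/250 : ℚ)) : ℝ) = 1 - (((147/1000 : ℚ)) : ℝ) - 1/1000 := by push_cast; norm_num
    rw [this]; linarith
  · have : (((477/500 : ℚ)) : ℝ) = 1 - (((47/1000 : ℚ)) : ℝ) + 1/1000 := by push_cast; norm_num
    rw [this]; linarith

/-! ## §5 The quotient rung `U/t_eff` and THE ERROR-BAR THEOREMS -/

/-- The typed `t_eff` row is a positive scale (`0 < 19/50`). [folklore] -/
theorem ndNiO2E_M21_t_encl_pos : 0 < ndNiO2E_M21_t.encl.fst := by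
  simp only [ndNiO2E_M21_t, Entry.encl_ofEnds_fst]; norm_num

/-- **The exact quotient rung of R-ak**: `divPos(U_abs hull [2.47, 3.2], t_eV (E) row [0.38, 0.49])` — the construction the lead names in
§OF-RECORD v1.7 (R-ak): «U/t (E) = divPos(U_abs hull [2.47, 3.2] eV, t_eV (E) [0.38, 0.49]) = [5.041, 8.421] ⇒ outward [5.0, 8.5]». [folklore] -/
def ndNiO2E_UoverT_exact : NonemptyInterval ℚ := ndNiO2_oneBandU_hull.divPos ndNiO2E_M21_t.encl ndNiO2E_M21_t_encl_pos

/-- Closed form of the exact quotient rung: `[247/49, 160/19] = [2.47/0.49, 3.2/0.38] ≈ [5.0408, 8.4211]`. [folklore] -/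
theorem ndNiO2E_UoverT_exact_ends : ndNiO2E_UoverT_exact.fst = 247/49 ∧ ndNiO2E_UoverT_exact.snd = 160/19 := by
  have h := NonemptyInterval.divPos_ends_of_nonneg (I := ndNiO2_oneBandU_hull) (T := ndNiO2E_M21_t.encl) ndNiO2E_M21_t_encl_pos
    (by simp only [ndNiO2_oneBandU_hull]; norm_num)
  rw [ndNiO2E_UoverT_exact, h.1, h.2]
  simp only [ndNiO2_oneBandU_hull, ndNiO2E_M21_t, Entry.encl_ofEnds_fst, Entry.encl_ofEnds_snd]; norm_num

/-- **ENCLOSURE**: the exact quotient rung `⊆ ndNiO2E_M21_U.encl = [5, 17/2]` (R-ak's outward 1-decimal print). [folklore] -/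
theorem ndNiO2E_UoverT_exact_le_entry : ndNiO2E_UoverT_exact ≤ ndNiO2E_M21_U.encl := by
  refine ⟨?_, ?_⟩
  · rw [ndNiO2E_UoverT_exact_ends.1]; simp only [ndNiO2E_M21_U, Entry.encl_ofEnds_fst]; norm_num
  · rw [ndNiO2E_UoverT_exact_ends.2]; simp only [ndNiO2E_M21_U, Entry.encl_ofEnds_snd]; norm_num

/-- **Printed slack of the `U/t_eff` row** (how much of `[5, 8.5]` is rounding, not determination): `247/49 − 5 = 2/49 ≈ 0.0408` below and
`17/2 − 160/19 = 3/38 ≈ 0.0789` above. [folklore] -/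
theorem ndNiO2E_UoverT_slack :
    ndNiO2E_UoverT_exact.fst - ndNiO2E_M21_U.encl.fst = 2/49 ∧ ndNiO2E_M21_U.encl.snd - ndNiO2E_UoverT_exact.snd = 3/38 := by
  rw [ndNiO2E_UoverT_exact_ends.1, ndNiO2E_UoverT_exact_ends.2]
  simp only [ndNiO2E_M21_U, Entry.encl_ofEnds_fst, Entry.encl_ofEnds_snd]; norm_num

/-- **THE `U/t_eff` ERROR-BAR THEOREM (real form).** For every `U` in the one-band hull of record and every `t_eff` in the typed `t_eff` row,
`U / t_eff` lies in the typed `U/t_eff` entry `[5, 17/2]` of `boxNdNiO2E_M21`. [folklore] -/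
theorem ndNiO2E_M21_U_mem_div {U t : ℝ} (hU : U ∈ ndNiO2_oneBandU_hull.ratCast ℝ) (ht : ndNiO2E_M21_t.Mem t) :
    ndNiO2E_M21_U.Mem (U / t) :=
  mem_ratCast_of_le ndNiO2E_UoverT_exact_le_entry (div_mem_divPos ndNiO2E_M21_t_encl_pos hU ht)

/-- Member form: every admitted `U` member divided by any enclosed `t_eff` is enclosed by `ndNiO2E_M21_U`. [folklore] -/
theorem ndNiO2E_M21_U_mem_of_member_div {m : ℚ} (hm : m ∈ ndNiO2_oneBandU_members) {t : ℝ} (ht : ndNiO2E_M21_t.Mem t) :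
    ndNiO2E_M21_U.Mem ((m : ℝ) / t) := by
  have h := ndNiO2_oneBandU_members_subset_hull m hm
  exact ndNiO2E_M21_U_mem_div (mem_ratCast_iff.2 ⟨by exact_mod_cast h.1, by exact_mod_cast h.2⟩) ht

/-- **SOUNDNESS OF THE BOX OF RECORD (column M21, object E) — every admitted determination is a member.** Let a parameter vector `p` have:
`t_eff = p tEV` in the INFL-T rung of the refit members; `U/t_eff = U / t_eff` for some `U` in the one-band hull of record; `t'/t_eff` in the
refit member hull; filling `1 − dsd` for some `dsd` in the INFL-4f-floored `dsd` row; `t''/t_eff = 0` (object E by definition). Then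
`p ∈ boxNdNiO2E_M21`. This is the direction that makes every word `HoldsOn W boxNdNiO2E_M21` APPLY to each determination. [folklore] -/
theorem ndNiO2E_M21_mem_of_determination (p : OneBandCoord → ℝ) {U d : ℝ}
    (hU : U ∈ ndNiO2_oneBandU_hull.ratCast ℝ) (ht : p .tEV ∈ ndNiO2E_t_rung.ratCast ℝ) (hUt : p .UOverT = U / p .tEV)
    (htp : p .tpOverT ∈ ndNiO2E_tp_hull.ratCast ℝ) (hd : d ∈ (ndNiO2_dsd_hull.floorTo (1/20)).ratCast ℝ) (hn : p .filling = 1 - d)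
    (htpp : p .tppOverT = 0) : boxNdNiO2E_M21.Mem p := by
  have hT : ndNiO2E_M21_t.Mem (p .tEV) := ndNiO2E_M21_t_mem_of_mem_rung ht
  have hUm : ndNiO2E_M21_U.Mem (p .UOverT) := by rw [hUt]; exact ndNiO2E_M21_U_mem_div hU hT
  have hSm : ndNiO2E_M21_tp.Mem (p .tpOverT) := mem_ratCast_of_le ndNiO2E_tp_hull_le_entry htp
  have hNm : ndNiO2E_M21_n.Mem (p .filling) := by rw [hn]; exact ndNiO2E_M21_n_mem_of_dsd hd
  rw [boxNdNiO2E_M21_mem_iff]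
  rw [Entry.Mem, mem_ratCast_iff, ndNiO2E_M21_U, Entry.encl_ofEnds_fst, Entry.encl_ofEnds_snd] at hUm
  rw [Entry.Mem, mem_ratCast_iff, ndNiO2E_M21_tp, Entry.encl_ofEnds_fst, Entry.encl_ofEnds_snd] at hSm
  rw [Entry.Mem, mem_ratCast_iff, ndNiO2E_M21_n, Entry.encl_ofEnds_fst, Entry.encl_ofEnds_snd] at hNm
  rw [Entry.Mem, mem_ratCast_iff, ndNiO2E_M21_t, Entry.encl_ofEnds_fst, Entry.encl_ofEnds_snd] at hT
  refine ⟨hUm.1, hUm.2, hSm.1, hSm.2, hNm.1, hNm.2, hT.1, hT.2, ?_, ?_⟩ <;> rw [htpp] <;> norm_num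

/-! ## §6 (append, same seat) FILLING-ABSTRACT membership doors on all four object-E columns (M21 / M22 / M59 / M60)
The doped columns carry the parent's `U/t_eff`, `t'/t_eff`, `t_eff`, `t''/t_eff` entries VERBATIM (family rows, §OF-RECORD v1 «hoppings for M22: parent
intervals reused (INFL-dop inside FLOOR)»; the `x = 0.2` charged-cell refits ARE members of the §2–§3 hulls), so §5's determination ladder words every
column once its filling hypothesis is stated as membership in THAT column's typed `n` entry — the door the filling ladder (seat unc-3) plugs into. -/

/-- **M21, filling abstract**: as `ndNiO2E_M21_mem_of_determination` but with the filling given as `ndNiO2E_M21_n.Mem` (any typed dsd object). [folklore] -/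
theorem ndNiO2E_M21_mem_of_determination' (p : OneBandCoord → ℝ) {U : ℝ}
    (hU : U ∈ ndNiO2_oneBandU_hull.ratCast ℝ) (ht : p .tEV ∈ ndNiO2E_t_rung.ratCast ℝ) (hUt : p .UOverT = U / p .tEV)
    (htp : p .tpOverT ∈ ndNiO2E_tp_hull.ratCast ℝ) (hn : ndNiO2E_M21_n.Mem (p .filling)) (htpp : p .tppOverT = 0) : boxNdNiO2E_M21.Mem p := by
  have hT : ndNiO2E_M21_t.Mem (p .tEV) := ndNiO2E_M21_t_mem_of_mem_rung ht
  have hUm : ndNiO2E_M21_U.Mem (p .UOverT) := by rw [hUt]; exact ndNiO2E_M21_U_mem_div hU hT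
  have hSm : ndNiO2E_M21_tp.Mem (p .tpOverT) := mem_ratCast_of_le ndNiO2E_tp_hull_le_entry htp
  intro i e hi
  cases i <;> simp only [boxNdNiO2E_M21, Option.some.injEq, reduceCtorEq] at hi <;> subst hi
  exacts [hUm, hSm, hn, hT, by rw [htpp]; exact (Entry.mem_ofEnds_iff _ _ _ _ _).2 ⟨by norm_num, by norm_num⟩]

/-- **M22 (Nd₀.₈Sr₀.₂NiO₂, x = 0.2)**: every object-E determination with filling in `ndSrNiO2E_M22_n = [0.718, 0.818]` is a member of `boxNdSrNiO2E_M22`. [folklore] -/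
theorem ndSrNiO2E_M22_mem_of_determination (p : OneBandCoord → ℝ) {U : ℝ}
    (hU : U ∈ ndNiO2_oneBandU_hull.ratCast ℝ) (ht : p .tEV ∈ ndNiO2E_t_rung.ratCast ℝ) (hUt : p .UOverT = U / p .tEV)
    (htp : p .tpOverT ∈ ndNiO2E_tp_hull.ratCast ℝ) (hn : ndSrNiO2E_M22_n.Mem (p .filling)) (htpp : p .tppOverT = 0) : boxNdSrNiO2E_M22.Mem p := by
  have hT : ndNiO2E_M21_t.Mem (p .tEV) := ndNiO2E_M21_t_mem_of_mem_rung ht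
  have hUm : ndNiO2E_M21_U.Mem (p .UOverT) := by rw [hUt]; exact ndNiO2E_M21_U_mem_div hU hT
  have hSm : ndNiO2E_M21_tp.Mem (p .tpOverT) := mem_ratCast_of_le ndNiO2E_tp_hull_le_entry htp
  intro i e hi
  cases i <;> simp only [boxNdSrNiO2E_M22, Option.some.injEq, reduceCtorEq] at hi <;> subst hi
  exacts [hUm, hSm, hn, hT, by rw [htpp]; exact (Entry.mem_ofEnds_iff _ _ _ _ _).2 ⟨by norm_num, by norm_num⟩]

/-- **M59 (Nd₀.₉Sr₀.₁NiO₂, x = 0.10)**: the same door with filling in `ndSrNiO2E_M59_n = [0.79, 0.89]`. [folklore] -/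
theorem ndSrNiO2E_M59_mem_of_determination (p : OneBandCoord → ℝ) {U : ℝ}
    (hU : U ∈ ndNiO2_oneBandU_hull.ratCast ℝ) (ht : p .tEV ∈ ndNiO2E_t_rung.ratCast ℝ) (hUt : p .UOverT = U / p .tEV)
    (htp : p .tpOverT ∈ ndNiO2E_tp_hull.ratCast ℝ) (hn : ndSrNiO2E_M59_n.Mem (p .filling)) (htpp : p .tppOverT = 0) : boxNdSrNiO2E_M59.Mem p := by
  have hT : ndNiO2E_M21_t.Mem (p .tEV) := ndNiO2E_M21_t_mem_of_mem_rung ht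
  have hUm : ndNiO2E_M21_U.Mem (p .UOverT) := by rw [hUt]; exact ndNiO2E_M21_U_mem_div hU hT
  have hSm : ndNiO2E_M21_tp.Mem (p .tpOverT) := mem_ratCast_of_le ndNiO2E_tp_hull_le_entry htp
  intro i e hi
  cases i <;> simp only [boxNdSrNiO2E_M59, Option.some.injEq, reduceCtorEq] at hi <;> subst hi
  exacts [hUm, hSm, hn, hT, by rw [htpp]; exact (Entry.mem_ofEnds_iff _ _ _ _ _).2 ⟨by norm_num, by norm_num⟩]

/-- **M60 (Nd₀.₇₅Sr₀.₂₅NiO₂, x = 0.25)**: the same door with filling in `ndSrNiO2E_M60_n = [0.686, 0.786]`. [folklore] -/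
theorem ndSrNiO2E_M60_mem_of_determination (p : OneBandCoord → ℝ) {U : ℝ}
    (hU : U ∈ ndNiO2_oneBandU_hull.ratCast ℝ) (ht : p .tEV ∈ ndNiO2E_t_rung.ratCast ℝ) (hUt : p .UOverT = U / p .tEV)
    (htp : p .tpOverT ∈ ndNiO2E_tp_hull.ratCast ℝ) (hn : ndSrNiO2E_M60_n.Mem (p .filling)) (htpp : p .tppOverT = 0) : boxNdSrNiO2E_M60.Mem p := by
  have hT : ndNiO2E_M21_t.Mem (p .tEV) := ndNiO2E_M21_t_mem_of_mem_rung ht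
  have hUm : ndNiO2E_M21_U.Mem (p .UOverT) := by rw [hUt]; exact ndNiO2E_M21_U_mem_div hU hT
  have hSm : ndNiO2E_M21_tp.Mem (p .tpOverT) := mem_ratCast_of_le ndNiO2E_tp_hull_le_entry htp
  intro i e hi
  cases i <;> simp only [boxNdSrNiO2E_M60, Option.some.injEq, reduceCtorEq] at hi <;> subst hi
  exacts [hUm, hSm, hn, hT, by rw [htpp]; exact (Entry.mem_ofEnds_iff _ _ _ _ _).2 ⟨by norm_num, by norm_num⟩]

end Summit.Ventures.CertifiedManyBodySolver.Downfold
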